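import Mathlib
import HarnessLib

/-!
# Route `KLProgramme` — crux C4a, S3 brick (B4) «(U1)-ZONE-ASSEMBLY» part 9: the LOOP PARTITION OF UNITY, generic layer — a period integral of a `2π`-periodic
# continuous integrand is the finite sum of its window integrals against a bump family whose `±2π`-periodisation sums to one; product rows for `Y·χ`

Cell `gate-hubbard-kl`, seat hubbard-kl-k3c3-p3 (g34; row «implicit-function / monotonicity route for μ(n)»).  Located brick for the (C)-closer lane / the (M4)
assembly of the umklapp first-order ϑ-layer (stub (C) `stub_twoLeg_curvature` of `KLRegimeEngineV17F2`, stmt-HubbardSuperconductivity-20437), memo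
HOME/hubbard-kl-k3c3-p3/U1-CAUSTIC-SUP.md §16.

WHY.  The box / zone / arc theorems of parts 2–8 bound ONE loop window `[φa, φb]` with a bump `X` supported in `(φa, φb)`.  The physical loop integral runs over the
whole loop circle `[v₀, v₀ + 2π]` with a `2π`-periodic integrand `g(v) = w(e)·Y(e,v)·(K e)′(ē(e,v))`; it is cut into windows by bumps `χ_j` (`j < J`, supports in
windows of length `≤ L` inside `(v₀ − 2π, v₀ + 4π)`) whose periodisation with the shifts `0, ±2π` sums to `1` on the period.  Pure measure-free calculus (continuity
everywhere), no tree objects: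
* **`intervalIntegral_period_eq_sum_windows`**: `∫_{v₀}^{v₀+2π} g = ∑_{j<J} ∫_{a_j}^{b_j} g·χ_j` (periodicity moves the `±2π` copies back, `integral_comp_add_right` /
  `integral_comp_sub_right`, adjacent intervals, `integral_eq_integral_of_support_subset`).
* `abs_mul_bump_le`, `abs_deriv_mul_bump_le`: `|Yχ| ≤ Y₀`, `|(Yχ)′| ≤ Y₁ + Y₀B₁` for `|Y| ≤ Y₀`, `|Y′| ≤ Y₁`, `|χ| ≤ 1`, `|χ′| ≤ B₁` (`C¹` factors);
  `tsupport_mul_bump_subset` (`tsupport (Y·χ) ⊆ tsupport χ`).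
References: FST II CPAM 51 (1998) §3 [cite: FeldmanSalmhoferTrubowitz1998] (sector / window decompositions of loop integrals); [folklore].
-/

noncomputable section

namespace Summit.HubbardSuperconductivity.HubbardSuperconductivity.Theorems.C4a

set_option linter.dupNamespace false -- summit = problem name (single-conjunct summit), D-0017

open Real Set MeasureTheory intervalIntegral

/-- **A PERIOD INTEGRAL IS THE SUM OF ITS WINDOW INTEGRALS**: `g` continuous and `2π`-periodic; bumps `χ_j` (`j < J`) continuous with `tsupport χ_j ⊆ (a_j, b_j) ⊆
(v₀ − 2π, v₀ + 4π)`; `∑_{j<J} (χ_j(v) + χ_j(v + 2π) + χ_j(v − 2π)) = 1` on `[v₀, v₀ + 2π]` ⟹ `∫_{v₀}^{v₀+2π} g = ∑_{j<J} ∫_{a_j}^{b_j} g·χ_j`. [folklore] -/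
theorem intervalIntegral_period_eq_sum_windows {g : ℝ → ℝ} (hg : Continuous g) (hper : ∀ v, g (v + 2 * π) = g v) {J : ℕ} {χ : ℕ → ℝ → ℝ}
    {a b : ℕ → ℝ} {v₀ : ℝ} (hχc : ∀ j < J, Continuous (χ j)) (hχs : ∀ j < J, tsupport (χ j) ⊆ Ioo (a j) (b j))
    (hwin : ∀ j < J, Ioo (a j) (b j) ⊆ Ioo (v₀ - 2 * π) (v₀ + 4 * π))
    (hsum : ∀ v ∈ Icc v₀ (v₀ + 2 * π), ∑ j ∈ Finset.range J, (χ j v + χ j (v + 2 * π) + χ j (v - 2 * π)) = 1) :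
    ∫ v in v₀..(v₀ + 2 * π), g v = ∑ j ∈ Finset.range J, ∫ v in (a j)..(b j), g v * χ j v := by
  have hπ := Real.pi_pos
  have hle : v₀ ≤ v₀ + 2 * π := by linarith
  -- insert the partition of unity
  have h1 : ∫ v in v₀..(v₀ + 2 * π), g v =
      ∫ v in v₀..(v₀ + 2 * π), ∑ j ∈ Finset.range J, (g v * χ j v + g v * χ j (v + 2 * π) + g v * χ j (v - 2 * π)) := by
    refine intervalIntegral.integral_congr fun v hv => ?_
    rw [uIcc_of_le hle] at hv
    have hs := hsum v hv
    have : ∑ j ∈ Finset.range J, (g v * χ j v + g v * χ j (v + 2 * π) + g v * χ j (v - 2 * π)) =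
        g v * ∑ j ∈ Finset.range J, (χ j v + χ j (v + 2 * π) + χ j (v - 2 * π)) := by
      rw [Finset.mul_sum]; refine Finset.sum_congr rfl fun j _ => by ring
    simp only [this, hs, mul_one]
  -- continuity of the pieces
  have hcont : ∀ j < J, Continuous fun v => g v * χ j v := fun j hj => hg.mul (hχc j hj)
  have hcontp : ∀ j < J, Continuous fun v => g v * χ j (v + 2 * π) := fun j hj =>
    hg.mul ((hχc j hj).comp (continuous_id.add continuous_const))
  have hcontm : ∀ j < J, Continuous fun v => g v * χ j (v - 2 * π) := fun j hj =>
    hg.mul ((hχc j hj).comp (continuous_id.sub continuous_const))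
  have hint : ∀ j ∈ Finset.range J, IntervalIntegrable (fun v => g v * χ j v + g v * χ j (v + 2 * π) + g v * χ j (v - 2 * π)) volume v₀ (v₀ + 2 * π) :=
    fun j hj => by
      have hj' := Finset.mem_range.1 hj
      exact (((hcont j hj').add (hcontp j hj')).add (hcontm j hj')).intervalIntegrable _ _
  rw [h1, intervalIntegral.integral_finsetSum hint]
  refine Finset.sum_congr rfl fun j hj => ?_
  have hj := Finset.mem_range.1 hj
  -- the three pieces of window `j`
  have hI0 : IntervalIntegrable (fun v => g v * χ j v) volume v₀ (v₀ + 2 * π) := (hcont j hj).intervalIntegrable _ _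
  have hI2 : IntervalIntegrable (fun v => g v * χ j (v + 2 * π)) volume v₀ (v₀ + 2 * π) := (hcontp j hj).intervalIntegrable _ _
  have hI3 : IntervalIntegrable (fun v => g v * χ j (v - 2 * π)) volume v₀ (v₀ + 2 * π) := (hcontm j hj).intervalIntegrable _ _
  have hI1 : IntervalIntegrable (fun v => g v * χ j v + g v * χ j (v + 2 * π)) volume v₀ (v₀ + 2 * π) := hI0.add hI2
  rw [intervalIntegral.integral_add hI1 hI3, intervalIntegral.integral_add hI0 hI2]
  -- move the shifted copies by periodicity
  have hp : ∫ v in v₀..(v₀ + 2 * π), g v * χ j (v + 2 * π) = ∫ v in (v₀ + 2 * π)..(v₀ + 2 * π + 2 * π), g v * χ j v := by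
    have e1 : ∫ v in v₀..(v₀ + 2 * π), g v * χ j (v + 2 * π) = ∫ v in v₀..(v₀ + 2 * π), (fun u => g u * χ j u) (v + 2 * π) := by
      refine intervalIntegral.integral_congr fun v _ => ?_
      simp only [hper v]
    rw [e1, intervalIntegral.integral_comp_add_right (fun u => g u * χ j u)]
  have hm : ∫ v in v₀..(v₀ + 2 * π), g v * χ j (v - 2 * π) = ∫ v in (v₀ - 2 * π)..(v₀ + 2 * π - 2 * π), g v * χ j v := by
    have e1 : ∫ v in v₀..(v₀ + 2 * π), g v * χ j (v - 2 * π) = ∫ v in v₀..(v₀ + 2 * π), (fun u => g u * χ j u) (v - 2 * π) := by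
      refine intervalIntegral.integral_congr fun v _ => ?_
      have := hper (v - 2 * π)
      rw [sub_add_cancel] at this
      simp only [this]
    rw [e1, intervalIntegral.integral_comp_sub_right (fun u => g u * χ j u)]
  rw [hp, hm, show v₀ + 2 * π - 2 * π = v₀ by ring]
  -- glue the three adjacent intervals
  have hI : ∀ p q : ℝ, IntervalIntegrable (fun v => g v * χ j v) volume p q := fun p q => (hcont j hj).intervalIntegrable _ _
  have hglue : ((∫ v in v₀..(v₀ + 2 * π), g v * χ j v) + ∫ v in (v₀ + 2 * π)..(v₀ + 2 * π + 2 * π), g v * χ j v) +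
      ∫ v in (v₀ - 2 * π)..v₀, g v * χ j v = ∫ v in (v₀ - 2 * π)..(v₀ + 2 * π + 2 * π), g v * χ j v := by
    rw [intervalIntegral.integral_add_adjacent_intervals (hI _ _) (hI _ _), add_comm,
      intervalIntegral.integral_add_adjacent_intervals (hI _ _) (hI _ _)]
  rw [hglue]
  -- both sides are the integral over the support window
  have hmem : ∀ v, g v * χ j v ≠ 0 → v ∈ Ioo (a j) (b j) := fun v hv => by
    have hχ : χ j v ≠ 0 := fun h0 => hv (by rw [h0, mul_zero])
    exact hχs j hj (subset_tsupport _ (Function.mem_support.2 hχ))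
  have hsupp : Function.support (fun v => g v * χ j v) ⊆ Ioc (a j) (b j) := fun v hv => Ioo_subset_Ioc_self (hmem v hv)
  have hsupp' : Function.support (fun v => g v * χ j v) ⊆ Ioc (v₀ - 2 * π) (v₀ + 2 * π + 2 * π) := fun v hv => by
    have h := hwin j hj (hmem v hv)
    exact ⟨h.1, by linarith [h.2]⟩
  rw [intervalIntegral.integral_eq_integral_of_support_subset hsupp, intervalIntegral.integral_eq_integral_of_support_subset hsupp']

/-- `|Y·χ| ≤ Y₀` for `|Y| ≤ Y₀`, `|χ| ≤ 1`. -/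
theorem abs_mul_bump_le {Y χ : ℝ → ℝ} {Y₀ : ℝ} (hYb : ∀ v, |Y v| ≤ Y₀) (hχb : ∀ v, |χ v| ≤ 1) (v : ℝ) : |Y v * χ v| ≤ Y₀ := by
  rw [abs_mul]
  have h0 : 0 ≤ Y₀ := (abs_nonneg _).trans (hYb v)
  nlinarith [hYb v, hχb v, abs_nonneg (Y v), abs_nonneg (χ v)]

/-- `|(Y·χ)′| ≤ Y₁ + Y₀·B₁` for `C¹` factors with `|Y| ≤ Y₀`, `|Y′| ≤ Y₁`, `|χ| ≤ 1`, `|χ′| ≤ B₁`. -/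
theorem abs_deriv_mul_bump_le {Y χ : ℝ → ℝ} {Y₀ Y₁ B₁ : ℝ} (hYd : ContDiff ℝ 1 Y) (hχd : ContDiff ℝ 1 χ) (hYb : ∀ v, |Y v| ≤ Y₀)
    (hY1 : ∀ v, |deriv Y v| ≤ Y₁) (hχb : ∀ v, |χ v| ≤ 1) (hχ1 : ∀ v, |deriv χ v| ≤ B₁) (v : ℝ) :
    |deriv (fun u => Y u * χ u) v| ≤ Y₁ + Y₀ * B₁ := by
  have hYv : DifferentiableAt ℝ Y v := (hYd.differentiable one_ne_zero).differentiableAt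
  have hχv : DifferentiableAt ℝ χ v := (hχd.differentiable one_ne_zero).differentiableAt
  have hd : deriv (fun u => Y u * χ u) v = deriv Y v * χ v + Y v * deriv χ v := (hYv.hasDerivAt.mul hχv.hasDerivAt).deriv
  rw [hd]
  have h0 : 0 ≤ Y₀ := (abs_nonneg _).trans (hYb v)
  have h1 : |deriv Y v * χ v| ≤ Y₁ := by
    rw [abs_mul]; nlinarith [hY1 v, hχb v, abs_nonneg (deriv Y v), abs_nonneg (χ v)]
  have h2 : |Y v * deriv χ v| ≤ Y₀ * B₁ := by
    rw [abs_mul]; exact mul_le_mul (hYb v) (hχ1 v) (abs_nonneg _) h0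
  exact (abs_add_le _ _).trans (add_le_add h1 h2)

/-- `tsupport (Y·χ) ⊆ tsupport χ`. -/
theorem tsupport_mul_bump_subset (Y χ : ℝ → ℝ) : tsupport (fun u => Y u * χ u) ⊆ tsupport χ :=
  tsupport_mul_subset_right

end Summit.HubbardSuperconductivity.HubbardSuperconductivity.Theorems.C4a

end
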